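import Summits.CriticalPhenomena.SAWScalingLimit.Theorems.SAWLeftRightFKGFKGToTraversalBoundWitnessMonoEscapes
import Summits.CriticalPhenomena.SAWScalingLimit.Theorems.SAWLeftRightFKGFKGToTraversalBoundWitnessChildSide
import Summits.CriticalPhenomena.SAWScalingLimit.Theorems.SAWLeftRightFKGFKGToTraversalBoundBoundaryBudget
import HarnessLib

/-!
# Witness glue T6, part 2: rest-class contacts of the window accounting

Crux `SAWLeftRightFKG.FKGToTraversalBound` (stmt-CriticalPhenomena-1878), line `slit-necklace`, lead
prover-line-stmt-CriticalPhenomena-1878-c5-0; witness glue unit T6 (the window ACCOUNTING along one outline arc of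
the free component: `witness_accounting`), part 2 of 3, on top of `…WitnessRestClass`, `…WitnessMonoEscapes`,
`…WitnessChildSide` and the boundary-budget vocabulary `…BoundaryBudget`.

For a far-tip configuration `cfg` (vocabulary `…WitnessCfg`) and the REST CLASS
`Ω₀ z :≡ z ∉ Λ ∨ z ∈ Sp ∨ (z ∈ Ext ∧ z is interior to no non-degenerate far piece other than P)`:
the rest class misses the interior of every non-degenerate far piece other than `P` (`accr_rest_notMem_V`); the
two tip neighbours `γ (τ - 1)`, `γ (τ' + 1)` are interior to no far piece other than `P` (`accr_tip_notMem_V`);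
the KEY CLASSIFICATION (`accr_restFar_notMem`, registered): a FAR rest-class site that is neither a defect nor the
single interior vertex of a degenerate far piece lies off the lattice domain `Λ`; and FACING (`accr_facesBoundary`):
a boundary edge of the free set `F` whose contact is off `Λ` and not a defect faces the boundary of the domain.

All statements folklore; no literature fact; nothing restates the crux.
-/

noncomputable section

open Set
open Literature.Probability.LatticeModels
open Literature.Probability.RandomPlanarGeometry
open Summit.CriticalPhenomena.SAWScalingLimit.Theorems.FKGToTraversalBound.Negative (dom)

namespace Summit.CriticalPhenomena.SAWScalingLimit.Theorems.FKGToTraversalBound.SlitNecklace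

variable {D : DobrushinDomain}

/-! ### Small configuration facts -/

/-- The reach is at least three meshes: `0 ≤ ιa` (the blob `Ka` contains `a₀`) and `ιa + 3δ ≤ η`. [folklore] -/
theorem accr_eta (cfg : FarTipCfg D) : 3 * cfg.δ ≤ cfg.η := by
  have h1 := cfg.hKa cfg.a₀ cfg.ha₀
  have h2 := cfg.hιa
  linarith [dist_nonneg (x := meshPoint cfg.δ cfg.a₀) (y := cfg.ca)]

/-- A point within `2δ` of a point of the band (which is `2η`-far from both centres) is far. [folklore] -/
theorem accr_isFarPt_of_near (cfg : FarTipCfg D) {P Q : ℂ} (hca : 2 * cfg.η ≤ dist P cfg.ca)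
    (hcb : 2 * cfg.η ≤ dist P cfg.cb) (hPQ : dist P Q ≤ 2 * cfg.δ) : IsFarPt Q cfg.ca cfg.cb cfg.η := by
  have hη := accr_eta cfg
  have hδ := cfg.hδ
  constructor
  · linarith [dist_triangle P Q cfg.ca]
  · linarith [dist_triangle P Q cfg.cb]

/-- The far starts form a finite set of `nfar` indices. [folklore] -/
theorem accr_exists_farFin (cfg : FarTipCfg D) :
    ∃ T : Finset ℕ, (∀ i', i' ∈ T ↔ i' ∈ cfg.farStarts) ∧ T.card = cfg.nfar := by
  classical
  set T := (Finset.range (cfg.γ.length + 1)).filter (fun i' => i' ∈ cfg.farStarts) with hTdef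
  have hT : ∀ i', i' ∈ T ↔ i' ∈ cfg.farStarts := by
    intro i'
    rw [hTdef, Finset.mem_filter, Finset.mem_range]
    constructor
    · exact fun h => h.2
    · intro h
      have := cfg.child_idx_of_mem_farStarts h
      exact ⟨by omega, h⟩
  have hco : (↑T : Set ℕ) = cfg.farStarts := Set.ext fun i' => by rw [Finset.mem_coe]; exact hT i'
  refine ⟨T, hT, ?_⟩
  unfold PresCfg.nfar
  rw [← hco, Set.ncard_coe_finset]

/-! ### The rest class and the interiors of far pieces -/

/-- **The rest class misses the interior of every non-degenerate far piece other than `P`**: interior vertices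
of such a piece are lattice-domain sites (`mono_interior_mem_Λ`) off the spine. [folklore] -/
theorem accr_rest_notMem_V (cfg : FarTipCfg D) {z : Site 2}
    (hz : z ∉ cfg.Λ ∨ z ∈ cfg.Sp ∨ (z ∈ cfg.Ext ∧
      ∀ i'' ∈ cfg.farStarts, cfg.NonDeg i'' → i'' ≠ cfg.i → z ∉ cfg.V i'' (cfg.pend i'')))
    {i'' : ℕ} (hfs : i'' ∈ cfg.farStarts) (hnd : cfg.NonDeg i'') (hne : i'' ≠ cfg.i) :
    z ∉ cfg.V i'' (cfg.pend i'') := by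
  rintro ⟨m₁, h1, h2, rfl⟩
  rcases hz with hz | hz | ⟨-, hz⟩
  · exact hz (mono_interior_mem_Λ cfg hfs hnd h1 h2)
  · exact mono_interior_notMem_Sp cfg hfs h1 h2 hz
  · exact hz i'' hfs hnd hne ⟨m₁, h1, h2, rfl⟩

/-- **The tip neighbours are interior to no far piece other than `P`.** [folklore] -/
theorem accr_tip_notMem_V (cfg : FarTipCfg D) {i'' : ℕ} (hfs : i'' ∈ cfg.farStarts) (hne : i'' ≠ cfg.i)
    {z : Site 2} (hz : z = cfg.γ.getVert (cfg.τ - 1) ∨ z = cfg.γ.getVert (cfg.τ' + 1)) :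
    z ∉ cfg.V i'' (cfg.pend i'') := by
  rintro ⟨m₁, h1, h2, he⟩
  have hf := cfg.idx_facts
  have hL := (rest_isPiece_pend cfg hfs).2.1.1
  rcases hz with rfl | rfl
  · exact mono_pred_tip_ne cfg hfs hne h1 h2 he.symm
  · have hm : cfg.τ' + 1 = m₁ := mono_γ_inj cfg (by omega) (by omega) he.symm
    rcases mono_sep cfg hfs hne with h' | h' <;> omega

/-! ### The key classification of far rest-class contacts -/

/-- **Key classification (registered glue).**  A FAR site of the rest class that is not a defect site and not
the single interior vertex `γ (i₂ + 1)` of a degenerate far piece lies OFF the lattice domain `Λ`: a far site is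
in neither blob; an exterior chord vertex off the spine is interior to a piece `(i₂, j₂)` of `γ` — if `i₂ = cfg.i`
it is a near-stub vertex (not far), otherwise `(i₂, j₂)` is a far piece (it has a far interior vertex), hence
non-degenerate pieces are excluded by the rest-class clause and degenerate ones by hypothesis. [folklore] -/
theorem accr_restFar_notMem : ∀ {D : DobrushinDomain} (cfg : FarTipCfg D) (z : Site 2), (z ∉ cfg.Λ ∨ z ∈ cfg.Sp ∨ (z ∈ cfg.Ext ∧ ∀ i'' ∈ cfg.farStarts, cfg.NonDeg i'' → i'' ≠ cfg.i → z ∉ cfg.V i'' (cfg.pend i''))) → IsFarPt (meshPoint cfg.δ z) cfg.ca cfg.cb cfg.η → z ∉ cfg.S → (∀ i₂ ∈ cfg.farStarts, ¬ cfg.NonDeg i₂ → z ≠ cfg.γ.getVert (i₂ + 1)) → z ∉ cfg.Λ := by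
  intro D cfg z hz hfar hS hDeg hΛ
  have hδ := cfg.hδ
  -- a far site off the defects is not a spine site
  have hSp : z ∉ cfg.Sp := by
    intro h
    rw [PresCfg.Sp_def, Finset.mem_union, Finset.mem_union] at h
    rcases h with (h | h) | h
    · have h1 := cfg.hKa z h
      have h2 := cfg.hιa
      have h3 := hfar.1
      linarith
    · have h1 := cfg.hKb z h
      have h2 := cfg.hιb
      have h3 := hfar.2
      linarith
    · exact hS h
  rcases hz with hz | hz | ⟨hzE, hzV⟩
  · exact hz hΛ
  · exact hSp hz
  obtain ⟨m₀, hm₀L, hm₀τ, rfl⟩ := cfg.mem_Ext_iff.1 hzE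
  -- the piece `(i₂, j₂)` around the exterior index `m₀`
  obtain ⟨i₂, hi₂m, hi₂S, hmax⟩ := rest_exists_last_spineIdx cfg m₀
  obtain ⟨j₂, hj₂m, hj₂L, hj₂S, hmin⟩ := rest_exists_first_spineIdx cfg hm₀L
  have hi₂lt : i₂ < m₀ := lt_of_le_of_ne hi₂m fun h => hSp (by rw [← h]; exact hi₂S)
  have hj₂gt : m₀ < j₂ := lt_of_le_of_ne hj₂m fun h => hSp (by rw [h]; exact hj₂S)
  have hP : IsPiece cfg.γ (↑cfg.Sp) i₂ j₂ := by
    refine ⟨⟨by omega, Finset.mem_coe.2 hi₂S⟩, ⟨hj₂L, Finset.mem_coe.2 hj₂S⟩, by omega,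
      fun n hn1 hn2 hn => ?_⟩
    rcases le_or_gt n m₀ with h | h
    · exact hmax n hn1 h (Finset.mem_coe.1 hn)
    · exact hmin n h.le hn2 (Finset.mem_coe.1 hn)
  by_cases hi : i₂ = cfg.i
  · -- the exterior vertex is a near-stub vertex of `P` itself
    subst hi
    have hj : j₂ = cfg.j := cfg.child_isPiece_end_unique hP cfg.hft.1
    rcases hm₀τ with h | h
    · exact cfg.hft.2.2.2.2.2.2.1 m₀ hi₂lt h hfar
    · exact cfg.hft.2.2.2.2.2.2.2 m₀ h (hj ▸ hj₂gt) hfar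
  · -- a far piece other than `P`
    have hfp : IsFarPiece (meshPoint cfg.δ) cfg.γ (↑cfg.Sp) (↑cfg.S) i₂ j₂ cfg.ca cfg.cb cfg.η :=
      ⟨hP, Or.inr (Or.inr ⟨m₀, hi₂lt, hj₂gt, hfar.1, hfar.2⟩)⟩
    have hfs : i₂ ∈ cfg.farStarts := ⟨j₂, hfp⟩
    have hpend : cfg.pend i₂ = j₂ := cfg.child_pend_eq hP
    by_cases hnd : cfg.NonDeg i₂
    · exact hzV i₂ hfs hnd hi ⟨m₀, hi₂lt, hpend ▸ hj₂gt, rfl⟩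
    · have h3 : ¬ (i₂ + 3 ≤ cfg.pend i₂) := hnd
      have hm₀ : m₀ = i₂ + 1 := by omega
      exact hDeg i₂ hfs hnd (by rw [hm₀])

/-! ### Facing the boundary -/

/-- Sites of the free set are vertices of the domain graph `D_δ`: each has a lattice neighbour in `F` (`F` is
`4`-connected with two distinct sites), joined to it in the carrier graph, hence in `D_δ` (`cfg.hid`). [folklore] -/
theorem accr_mem_meshDomain (cfg : FarTipCfg D) (F : Finset (Site 2))
    (hFG : ∀ x ∈ F, ∀ x' ∈ F, (zdGraph 2).Adj x x' → cfg.G.Adj x x')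
    (hFconn : ∀ x ∈ F, ∀ x' ∈ F, ∃ w : (zdGraph 2).Walk x x', ∀ z ∈ w.support, z ∈ F)
    (h2 : ∃ u ∈ F, ∃ v ∈ F, u ≠ v) {f : Site 2} (hf : f ∈ F) : f ∈ meshDomain D.carrier cfg.δ := by
  obtain ⟨u, hu, v, hv, huv⟩ := h2
  obtain ⟨g, hg, hgf⟩ : ∃ g ∈ F, g ≠ f := by
    by_cases h : u = f
    · exact ⟨v, hv, fun h' => huv (h.trans h'.symm)⟩
    · exact ⟨u, hu, h⟩
  obtain ⟨w, hw⟩ := hFconn f hf g hg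
  have hlen : 0 < w.length := by
    rcases Nat.eq_zero_or_pos w.length with h | h
    · exact absurd (w.eq_of_length_eq_zero h) hgf.symm
    · exact h
  have hadj : (zdGraph 2).Adj f (w.getVert 1) := by
    have := w.adj_getVert_succ hlen
    rwa [SimpleGraph.Walk.getVert_zero] at this
  have h1 : w.getVert 1 ∈ F := hw _ (w.getVert_mem_support 1)
  have hDg := ((cfg.hid f (w.getVert 1)).1 (hFG f hf _ h1 hadj)).1
  exact (discreteDomainGraph_adj_iff.1 hDg).2.1

/-- **Facing lemma.**  A boundary edge `e` of the free set `F` (`F ⊆ B`, mesh points of `B` in the domain, `F` off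
the attached set, lattice-adjacent `F`-sites carrier-adjacent, `F` `4`-connected with two distinct sites) whose
contact site is off the lattice domain `Λ` and is not a defect FACES THE BOUNDARY of `D`: either the contact mesh
point is outside `D` (`facesBoundary_of_notMem`), or the unit segment leaves the closure of `D` — else the edge
would be an edge of `D_δ` between non-defect sites, i.e. a carrier edge (`cfg.hid`), putting the contact in `Λ`.
[folklore] -/
theorem accr_facesBoundary (cfg : FarTipCfg D) (F B : Finset (Site 2)) (hFB : F ⊆ B)
    (hBD : ∀ x ∈ B, meshPoint cfg.δ x ∈ D.carrier) (hFK : ∀ x ∈ F, x ∉ cfg.K)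
    (hFG : ∀ x ∈ F, ∀ x' ∈ F, (zdGraph 2).Adj x x' → cfg.G.Adj x x')
    (hFconn : ∀ x ∈ F, ∀ x' ∈ F, ∃ w : (zdGraph 2).Walk x x', ∀ z ∈ w.support, z ∈ F)
    (h2 : ∃ u ∈ F, ∃ v ∈ F, u ≠ v) {e : Site 2 × ODir} (he : IsBEdge (↑F : Set (Site 2)) e)
    (hΛ : bcontact e ∉ cfg.Λ) (hS : bcontact e ∉ cfg.S) : FacesBoundary D.carrier cfg.δ e := by
  have hf : bsite e ∈ F := Finset.mem_coe.1 he.1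
  have hfD : meshPoint cfg.δ (bsite e) ∈ D.carrier := hBD _ (hFB hf)
  by_cases hzD : meshPoint cfg.δ (bcontact e) ∈ D.carrier
  swap
  · exact facesBoundary_of_notMem _ _ _ hfD hzD
  -- the unit segment leaves the closure of `D`
  have hseg : ¬ segment ℝ (meshPoint cfg.δ (bsite e)) (meshPoint cfg.δ (bcontact e)) ⊆ closure D.carrier := by
    intro hsub
    have hmg : (meshGraph D.carrier cfg.δ).Adj (bsite e) (bcontact e) :=
      meshGraph_adj_iff.2 ⟨ODir.adj_add_vec e.1 e.2, hsub⟩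
    have hfm : bsite e ∈ meshDomain D.carrier cfg.δ := accr_mem_meshDomain cfg F hFG hFconn h2 hf
    have hzm : bcontact e ∈ meshDomain D.carrier cfg.δ :=
      Literature.Probability.Percolation.mem_meshDomain_of_meshGraph_adj hfm hzD hmg
    have hDg : cfg.Dg.Adj (bsite e) (bcontact e) := discreteDomainGraph_adj_iff.2 ⟨hmg, hfm, hzm⟩
    have hfS : bsite e ∉ cfg.S := fun h => hFK _ hf (by
      rw [FarTipCfg.K_def, Finset.mem_union, PresCfg.Sp_def]
      exact Or.inl (Finset.mem_union_right _ h))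
    have hG : cfg.G.Adj (bsite e) (bcontact e) := (cfg.hid _ _).2 ⟨hDg, hfS, hS⟩
    exact hΛ (discreteDomainGraph_adj_iff.1 hG).2.2
  obtain ⟨w, hw, hwf⟩ := Literature.Probability.Percolation.exists_mem_segment_frontier D.isOpen hfD
    (fun h => hseg (h.trans subset_closure))
  exact ⟨w, hw, hwf⟩

end Summit.CriticalPhenomena.SAWScalingLimit.Theorems.FKGToTraversalBound.SlitNecklace

end
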